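import Summits.RiemannHypothesis.RiemannHypothesis.Theorems.WeilFormatCDataO103MFrontDataW
import Summits.RiemannHypothesis.RiemannHypothesis.Theorems.WeilFormatCDataA1RungCB
import Summits.RiemannHypothesis.RiemannHypothesis.Theorems.S2FormatCE0
import Literature.NumberTheory.LFunctions.YoshidaWindowGramTailMSSines
import Literature.NumberTheory.LFunctions.YoshidaWindowGramMiddleJBox
import Literature.NumberTheory.LFunctions.YoshidaWindowGramTailJFactoredScaled
import Literature.NumberTheory.LFunctions.YoshidaWindowGramTailMSFactored
import Literature.NumberTheory.LFunctions.YoshidaWindowGramTailJDiagTight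
import Summits.RiemannHypothesis.RiemannHypothesis.Theorems.FormatCPsdBands
import Summits.RiemannHypothesis.RiemannHypothesis.Theorems.WeilFormatCDiagShift
import Summits.RiemannHypothesis.RiemannHypothesis.Theorems.FormatCPsdSymmBands
import HarnessLib
import Summits.RiemannHypothesis.RiemannHypothesis.Theorems.WeilFormatCDataO103MTables1
import Summits.RiemannHypothesis.RiemannHypothesis.Theorems.WeilFormatCDataO103MTables2
import Summits.RiemannHypothesis.RiemannHypothesis.Theorems.WeilFormatCDataO103MTables3
import Summits.RiemannHypothesis.RiemannHypothesis.Theorems.WeilFormatCDataO103MTables4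
import Summits.RiemannHypothesis.RiemannHypothesis.Theorems.WeilFormatCDataO103MTables
import Summits.RiemannHypothesis.RiemannHypothesis.Theorems.WeilFormatCDataO103MColTables1
import Summits.RiemannHypothesis.RiemannHypothesis.Theorems.WeilFormatCDataO103MColTables2
import Summits.RiemannHypothesis.RiemannHypothesis.Theorems.WeilFormatCDataO103MColTables3
import Summits.RiemannHypothesis.RiemannHypothesis.Theorems.WeilFormatCDataO103MColTables4
import Summits.RiemannHypothesis.RiemannHypothesis.Theorems.WeilFormatCDataO103MColTables5
import Summits.RiemannHypothesis.RiemannHypothesis.Theorems.WeilFormatCDataO103MColTables6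
import Summits.RiemannHypothesis.RiemannHypothesis.Theorems.WeilFormatCDataO103MColTables7
import Summits.RiemannHypothesis.RiemannHypothesis.Theorems.WeilFormatCDataO103MColTables8
import Summits.RiemannHypothesis.RiemannHypothesis.Theorems.WeilFormatCDataO103MColTables9
import Summits.RiemannHypothesis.RiemannHypothesis.Theorems.WeilFormatCDataO103MColTables10
import Summits.RiemannHypothesis.RiemannHypothesis.Theorems.WeilFormatCDataO103MColTables11
import Summits.RiemannHypothesis.RiemannHypothesis.Theorems.WeilFormatCDataO103MColTables12
import Summits.RiemannHypothesis.RiemannHypothesis.Theorems.WeilFormatCDataO103MColTables13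
import Summits.RiemannHypothesis.RiemannHypothesis.Theorems.WeilFormatCDataO103MColTables14
import Summits.RiemannHypothesis.RiemannHypothesis.Theorems.WeilFormatCDataO103MColTables15
import Summits.RiemannHypothesis.RiemannHypothesis.Theorems.WeilFormatCDataO103MColTables16
import Summits.RiemannHypothesis.RiemannHypothesis.Theorems.WeilFormatCDataO103MColTables17
import Summits.RiemannHypothesis.RiemannHypothesis.Theorems.WeilFormatCDataO103MColTables18
import Summits.RiemannHypothesis.RiemannHypothesis.Theorems.WeilFormatCDataO103MColTables19
import Summits.RiemannHypothesis.RiemannHypothesis.Theorems.WeilFormatCDataO103MColTables20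
import Summits.RiemannHypothesis.RiemannHypothesis.Theorems.WeilFormatCDataO103MColTables21
import Summits.RiemannHypothesis.RiemannHypothesis.Theorems.WeilFormatCDataO103MColTables22
import Summits.RiemannHypothesis.RiemannHypothesis.Theorems.WeilFormatCDataO103MColTables23
import Summits.RiemannHypothesis.RiemannHypothesis.Theorems.WeilFormatCDataO103MColTables24
import Summits.RiemannHypothesis.RiemannHypothesis.Theorems.WeilFormatCDataO103MColTables25
import Summits.RiemannHypothesis.RiemannHypothesis.Theorems.WeilFormatCDataO103MColTables26
import Summits.RiemannHypothesis.RiemannHypothesis.Theorems.WeilFormatCDataO103MColTables27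
import Summits.RiemannHypothesis.RiemannHypothesis.Theorems.WeilFormatCDataO103MColTables28
import Summits.RiemannHypothesis.RiemannHypothesis.Theorems.WeilFormatCDataO103MColTables29
import Summits.RiemannHypothesis.RiemannHypothesis.Theorems.WeilFormatCDataO103MColTables30
import Summits.RiemannHypothesis.RiemannHypothesis.Theorems.WeilFormatCDataO103MColTables31
import Summits.RiemannHypothesis.RiemannHypothesis.Theorems.WeilFormatCDataO103MColTables32
import Summits.RiemannHypothesis.RiemannHypothesis.Theorems.WeilFormatCDataO103MColTables33
import Summits.RiemannHypothesis.RiemannHypothesis.Theorems.WeilFormatCDataO103MColTables34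
import Summits.RiemannHypothesis.RiemannHypothesis.Theorems.WeilFormatCDataO103MColTables35
import Summits.RiemannHypothesis.RiemannHypothesis.Theorems.WeilFormatCDataO103MColTables
import Summits.RiemannHypothesis.RiemannHypothesis.Theorems.WeilFormatCDataO103MCBOddXP1
import Summits.RiemannHypothesis.RiemannHypothesis.Theorems.WeilFormatCDataO103MCBOddXP2
import Summits.RiemannHypothesis.RiemannHypothesis.Theorems.WeilFormatCDataO103MCBOddXP3
import Summits.RiemannHypothesis.RiemannHypothesis.Theorems.WeilFormatCDataO103MCBOddXP4
import Summits.RiemannHypothesis.RiemannHypothesis.Theorems.WeilFormatCDataO103MCBOddXP5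
import Summits.RiemannHypothesis.RiemannHypothesis.Theorems.WeilFormatCDataO103MCBOddXP6
import Summits.RiemannHypothesis.RiemannHypothesis.Theorems.WeilFormatCDataO103MCBOddXP7
import Summits.RiemannHypothesis.RiemannHypothesis.Theorems.WeilFormatCDataO103MCBOddXP8
import Summits.RiemannHypothesis.RiemannHypothesis.Theorems.WeilFormatCDataO103MCBOddXP9
import Summits.RiemannHypothesis.RiemannHypothesis.Theorems.WeilFormatCDataO103MCBOddXP10
import Summits.RiemannHypothesis.RiemannHypothesis.Theorems.WeilFormatCDataO103MCBOddXP11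
import Summits.RiemannHypothesis.RiemannHypothesis.Theorems.WeilFormatCDataO103MCBOddXP12
import Summits.RiemannHypothesis.RiemannHypothesis.Theorems.WeilFormatCDataO103MCBOddXP13
import Summits.RiemannHypothesis.RiemannHypothesis.Theorems.WeilFormatCDataO103MCBOddXP14
import Summits.RiemannHypothesis.RiemannHypothesis.Theorems.WeilFormatCDataO103MCBOddXP15
import Summits.RiemannHypothesis.RiemannHypothesis.Theorems.WeilFormatCDataO103MCBOddXP16
import Summits.RiemannHypothesis.RiemannHypothesis.Theorems.WeilFormatCDataO103MCBOddDSP1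
import Summits.RiemannHypothesis.RiemannHypothesis.Theorems.WeilFormatCDataO103MCBOddDSP2
import Summits.RiemannHypothesis.RiemannHypothesis.Theorems.WeilFormatCDataO103MCBOddDSP3
import Summits.RiemannHypothesis.RiemannHypothesis.Theorems.WeilFormatCDataO103MCBOddDSP4
import Summits.RiemannHypothesis.RiemannHypothesis.Theorems.WeilFormatCDataO103MCBOddDSP5
import Summits.RiemannHypothesis.RiemannHypothesis.Theorems.WeilFormatCDataO103MCBOddDSP6
import Summits.RiemannHypothesis.RiemannHypothesis.Theorems.WeilFormatCDataO103MCBOddDSP7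
import Summits.RiemannHypothesis.RiemannHypothesis.Theorems.WeilFormatCDataO103MCBOddDSP8
import Summits.RiemannHypothesis.RiemannHypothesis.Theorems.WeilFormatCDataO103MCBOddDSP9
import Summits.RiemannHypothesis.RiemannHypothesis.Theorems.WeilFormatCDataO103MCBOddDSP10
import Summits.RiemannHypothesis.RiemannHypothesis.Theorems.WeilFormatCDataO103MCBOddDSP11
import Summits.RiemannHypothesis.RiemannHypothesis.Theorems.WeilFormatCDataO103MCBOddDSP12
import Summits.RiemannHypothesis.RiemannHypothesis.Theorems.WeilFormatCDataO103MCBOddDSP13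
import Summits.RiemannHypothesis.RiemannHypothesis.Theorems.WeilFormatCDataO103MCBOddDSP14
import Summits.RiemannHypothesis.RiemannHypothesis.Theorems.WeilFormatCDataO103MCBOddDSP15
import Summits.RiemannHypothesis.RiemannHypothesis.Theorems.WeilFormatCDataO103MCBOddDSP16
import Summits.RiemannHypothesis.RiemannHypothesis.Theorems.WeilFormatCDataO103MCBOddDSP17
import Summits.RiemannHypothesis.RiemannHypothesis.Theorems.WeilFormatCDataO103MCBOddDSP18
import Summits.RiemannHypothesis.RiemannHypothesis.Theorems.WeilFormatCDataO103MCBOddDSP19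
import Summits.RiemannHypothesis.RiemannHypothesis.Theorems.WeilFormatCDataO103MCBOddLP1
import Summits.RiemannHypothesis.RiemannHypothesis.Theorems.WeilFormatCDataO103MCBOddLP2
import Summits.RiemannHypothesis.RiemannHypothesis.Theorems.WeilFormatCDataO103MCBOddLP3
import Summits.RiemannHypothesis.RiemannHypothesis.Theorems.WeilFormatCDataO103MCBOddLP4
import Summits.RiemannHypothesis.RiemannHypothesis.Theorems.WeilFormatCDataO103MCBOddLP5
import Summits.RiemannHypothesis.RiemannHypothesis.Theorems.WeilFormatCDataO103MCBOddLP6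
import Summits.RiemannHypothesis.RiemannHypothesis.Theorems.WeilFormatCDataO103MCBOddLP7
import Summits.RiemannHypothesis.RiemannHypothesis.Theorems.WeilFormatCDataO103MCBOddLP8
import Summits.RiemannHypothesis.RiemannHypothesis.Theorems.WeilFormatCDataO103MCBOddTF
import Summits.RiemannHypothesis.RiemannHypothesis.Theorems.WeilFormatCDataO103MCBOddRD
import Summits.RiemannHypothesis.RiemannHypothesis.Theorems.WeilFormatCDataO103MFrontData
import Summits.RiemannHypothesis.RiemannHypothesis.Theorems.WeilFormatCDataO103MColSlice26
import Summits.RiemannHypothesis.RiemannHypothesis.Theorems.WeilFormatCDataO103MColSlice27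
import Summits.RiemannHypothesis.RiemannHypothesis.Theorems.WeilFormatCDataO103MColSlice28
import Summits.RiemannHypothesis.RiemannHypothesis.Theorems.WeilFormatCDataO103MColSlice29
import Summits.RiemannHypothesis.RiemannHypothesis.Theorems.WeilFormatCDataO103MFront
import Summits.RiemannHypothesis.RiemannHypothesis.Theorems.WeilFormatCDataO103MFrontW1
import Summits.RiemannHypothesis.RiemannHypothesis.Theorems.WeilFormatCDataO103MFrontW2
import Summits.RiemannHypothesis.RiemannHypothesis.Theorems.WeilFormatCDataO103MMidEntAA
import Summits.RiemannHypothesis.RiemannHypothesis.Theorems.WeilFormatCDataO103MMidEntAB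
import Summits.RiemannHypothesis.RiemannHypothesis.Theorems.WeilFormatCDataO103MMidEntBA
import Summits.RiemannHypothesis.RiemannHypothesis.Theorems.WeilFormatCDataO103MMidBB
import Summits.RiemannHypothesis.RiemannHypothesis.Theorems.WeilFormatCDataO103MCBOddCols0
import Summits.RiemannHypothesis.RiemannHypothesis.Theorems.WeilFormatCDataO103MCBOddCols1
import Summits.RiemannHypothesis.RiemannHypothesis.Theorems.WeilFormatCDataO103MCBOddCols2
import Summits.RiemannHypothesis.RiemannHypothesis.Theorems.WeilFormatCDataO103MCBOddCols3
import Summits.RiemannHypothesis.RiemannHypothesis.Theorems.WeilFormatCDataO103MOddAsmA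
import Summits.RiemannHypothesis.RiemannHypothesis.Theorems.WeilFormatCDataO103MOddAsmC
import Summits.RiemannHypothesis.RiemannHypothesis.Theorems.WeilFormatCDataO103MOddAsmE2

/-!
# Format C kernel rung `O103M` (a = 103/100, column-band layout): ASSEMBLY of the flat layout, part F of 15 (ladders of ColSlice29 (cont.), Front, Mid, CBOddCols0, CBOddCols1, CBOddCols2, CBOddCols3; split of the 2979-line assembly at block boundaries by prover B g19 for the 400-line cap; blocks byte-identical): every propositional ladder of the kernel files (table/column validity, front door, sines, middle moments, column data, tail factors, Schur rows, (P) + diagonal shift), byte-identical statements and proofs, original order (A g22 restage_flat.py; weil-2 KERNEL-CHAIN-RULES #1)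

Window `a = 103/100`; prime powers in the window: 2, 3, 2^2, 5, 7; prime constant A = 2148/1000 (`WeilFormatC.primeCoeff_form_ge_cells_v2`); evaluator parameters S = 2^320, Kpi 160, Kser 190, kred 8, Kexp 55, J 150; full table modes < 257; light column table modes < 2051; units 2^-310 (Schur entries), 2^-154 (column digits, width 157), 2^-148 (tail-factor digits, width 151), 2^-64 (reciprocal weights), 2^-40 (tail base); order-J tail J = 4, θ = 1/2048, η = 1/10 | 4/1.
Design row: sr-gb-rung-b B g21 hp odd λ-run (parity cell 14 L-side): a = 103/100, A = 2148/1000 (cells_v2), μ = 2^-95, odd 256/512/2048, kit precision S 2^320 / c 310 / Kpi 160 / Kser 190 / Kexp 55 / J 150 (A g23 hp levers), MS tail; see HOME(B)/CELL14-LSIDE-B-g21.md. Generated by sr-gb-rung-a prover A g22 with rh-explicit-weil-2 gen7's generator extended for the odd λ-run (--sector odd --mu-log2; HOME(A)/code-g22/gen7/gramgen7.py sha16 b21c14hp103m0001) from `#eval` of the tree's `Encl` functions; every datum is re-verified by the kernel in the theorem files (`decide +kernel`). Helper data of the rh-explicit Weil-positivity programme (format C, K-CELL-2), RH-free. [cite: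 Yoshida1992HermitianForms, §5 (5.15)-(5.16) p. 301; §7 pp. 305–312]
-/

set_option linter.dupNamespace false
set_option exponentiation.threshold 1024
set_option maxRecDepth 200000

-- ===== from WeilFormatCDataO103MColSlice29 (continued) =====
namespace Summit.RiemannHypothesis.RiemannHypothesis.Theorems.WeilFormatCData.O103M
open Literature.NumberTheory.LFunctions Literature.NumberTheory.LFunctions.Yoshida1992 Encl Literature.Analysis.ValidatedNumerics.NumericsMP

/-- the light column table is valid on `[256, 2051)`. -/
theorem ctab_valid : TabColValid (2 ^ 320) O103M.a O103M.ks 256 2051 O103M.ctab := by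
  have h1846 : TabColValid (2 ^ 320) a ks 256 (1836 + 10) ctab := (not_not.mp ctab_valid_p2b)
  have h1856 : TabColValid (2 ^ 320) a ks 256 (1846 + 10) ctab :=
    h1846.extend fun m hm hmk ↦ colValid_of_checkTableCol (prm := prm) (by norm_num [prm]) a_pos consts_valid tC1846 hm hmk
  have h1866 : TabColValid (2 ^ 320) a ks 256 (1856 + 10) ctab :=
    h1856.extend fun m hm hmk ↦ colValid_of_checkTableCol (prm := prm) (by norm_num [prm]) a_pos consts_valid tC1856 hm hmk
  have h1876 : TabColValid (2 ^ 320) a ks 256 (1866 + 10) ctab :=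
    h1866.extend fun m hm hmk ↦ colValid_of_checkTableCol (prm := prm) (by norm_num [prm]) a_pos consts_valid tC1866 hm hmk
  have h1886 : TabColValid (2 ^ 320) a ks 256 (1876 + 10) ctab :=
    h1876.extend fun m hm hmk ↦ colValid_of_checkTableCol (prm := prm) (by norm_num [prm]) a_pos consts_valid tC1876 hm hmk
  have h1896 : TabColValid (2 ^ 320) a ks 256 (1886 + 10) ctab :=
    h1886.extend fun m hm hmk ↦ colValid_of_checkTableCol (prm := prm) (by norm_num [prm]) a_pos consts_valid tC1886 hm hmk
  have h1906 : TabColValid (2 ^ 320) a ks 256 (1896 + 10) ctab :=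
    h1896.extend fun m hm hmk ↦ colValid_of_checkTableCol (prm := prm) (by norm_num [prm]) a_pos consts_valid tC1896 hm hmk
  have h1916 : TabColValid (2 ^ 320) a ks 256 (1906 + 10) ctab :=
    h1906.extend fun m hm hmk ↦ colValid_of_checkTableCol (prm := prm) (by norm_num [prm]) a_pos consts_valid tC1906 hm hmk
  have h1926 : TabColValid (2 ^ 320) a ks 256 (1916 + 10) ctab :=
    h1916.extend fun m hm hmk ↦ colValid_of_checkTableCol (prm := prm) (by norm_num [prm]) a_pos consts_valid tC1916 hm hmk
  have h1936 : TabColValid (2 ^ 320) a ks 256 (1926 + 10) ctab :=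
    h1926.extend fun m hm hmk ↦ colValid_of_checkTableCol (prm := prm) (by norm_num [prm]) a_pos consts_valid tC1926 hm hmk
  have h1946 : TabColValid (2 ^ 320) a ks 256 (1936 + 10) ctab :=
    h1936.extend fun m hm hmk ↦ colValid_of_checkTableCol (prm := prm) (by norm_num [prm]) a_pos consts_valid tC1936 hm hmk
  have h1956 : TabColValid (2 ^ 320) a ks 256 (1946 + 10) ctab :=
    h1946.extend fun m hm hmk ↦ colValid_of_checkTableCol (prm := prm) (by norm_num [prm]) a_pos consts_valid tC1946 hm hmk
  have h1966 : TabColValid (2 ^ 320) a ks 256 (1956 + 10) ctab :=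
    h1956.extend fun m hm hmk ↦ colValid_of_checkTableCol (prm := prm) (by norm_num [prm]) a_pos consts_valid tC1956 hm hmk
  have h1976 : TabColValid (2 ^ 320) a ks 256 (1966 + 10) ctab :=
    h1966.extend fun m hm hmk ↦ colValid_of_checkTableCol (prm := prm) (by norm_num [prm]) a_pos consts_valid tC1966 hm hmk
  have h1986 : TabColValid (2 ^ 320) a ks 256 (1976 + 10) ctab :=
    h1976.extend fun m hm hmk ↦ colValid_of_checkTableCol (prm := prm) (by norm_num [prm]) a_pos consts_valid tC1976 hm hmk
  have h1996 : TabColValid (2 ^ 320) a ks 256 (1986 + 10) ctab :=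
    h1986.extend fun m hm hmk ↦ colValid_of_checkTableCol (prm := prm) (by norm_num [prm]) a_pos consts_valid tC1986 hm hmk
  have h2006 : TabColValid (2 ^ 320) a ks 256 (1996 + 10) ctab :=
    h1996.extend fun m hm hmk ↦ colValid_of_checkTableCol (prm := prm) (by norm_num [prm]) a_pos consts_valid tC1996 hm hmk
  have h2016 : TabColValid (2 ^ 320) a ks 256 (2006 + 10) ctab :=
    h2006.extend fun m hm hmk ↦ colValid_of_checkTableCol (prm := prm) (by norm_num [prm]) a_pos consts_valid tC2006 hm hmk
  have h2026 : TabColValid (2 ^ 320) a ks 256 (2016 + 10) ctab :=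
    h2016.extend fun m hm hmk ↦ colValid_of_checkTableCol (prm := prm) (by norm_num [prm]) a_pos consts_valid tC2016 hm hmk
  have h2036 : TabColValid (2 ^ 320) a ks 256 (2026 + 10) ctab :=
    h2026.extend fun m hm hmk ↦ colValid_of_checkTableCol (prm := prm) (by norm_num [prm]) a_pos consts_valid tC2026 hm hmk
  have h2046 : TabColValid (2 ^ 320) a ks 256 (2036 + 10) ctab :=
    h2036.extend fun m hm hmk ↦ colValid_of_checkTableCol (prm := prm) (by norm_num [prm]) a_pos consts_valid tC2036 hm hmk
  have h2051 : TabColValid (2 ^ 320) a ks 256 (2046 + 5) ctab :=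
    h2046.extend fun m hm hmk ↦ colValid_of_checkTableCol (prm := prm) (by norm_num [prm]) a_pos consts_valid tC2046 hm hmk
  exact h2051

end Summit.RiemannHypothesis.RiemannHypothesis.Theorems.WeilFormatCData.O103M

-- ===== from WeilFormatCDataO103MFront =====
namespace Summit.RiemannHypothesis.RiemannHypothesis.Theorems.WeilFormatCData.O103M
open Literature.NumberTheory.LFunctions Literature.NumberTheory.LFunctions.Yoshida1992 Encl Literature.Analysis.ValidatedNumerics.NumericsMP

/-- odd column range (kit form). -/
theorem ctab_valid_odd : TabColValid (2 ^ 320) O103M.a O103M.ks 256 (2048 + 2) O103M.ctab :=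
  fun m hm hmk ↦ ctab_valid m (by omega) (by omega)

/-- odd column range (column-data form). -/
theorem ctab_valid_oddK : TabColValid (2 ^ 320) O103M.a O103M.ks 256 (256 + 256 + 1) O103M.ctab :=
  fun m hm hmk ↦ ctab_valid m (by omega) (by omega)

/-- the front-door constants are valid for `a`. -/
theorem fd_valid : FDValid (2 ^ 320) O103M.a O103M.F :=
  fdValid_of_check (prm := prm) (ks := ks) (by norm_num [prm]) primeData consts_valid tF

/-- `FA` is valid with the certified prime constant `A = 2148/1000` plus the margin μ = 2^-95. -/
theorem fdA_valid : FDValidA (2 ^ 320) O103M.a (((10636380817539987321933275332733 : ℤ) : ℝ) / (4951760157141521099596496896000 : ℕ)) O103M.FA :=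
  fd_valid.withFrac 10636380817539987321933275332733 (by norm_num)

/-- λ-run: `FA` is valid with `A + 2·lam`, `lam = lamZ·2^-310`, `lamZ = 26328072917139296674479506920917608079723773850137277813577744384` (the shape the odd λ-door reads). -/
theorem fdA_valid_shift : FDValidA (2 ^ 320) O103M.a (((2148 : ℤ) : ℝ) / (1000 : ℕ) + 2 * ((((2 ^ 214 : ℤ) : ℤ) : ℝ) * (1 / 2 ^ 310))) O103M.FA := by
  convert fdA_valid using 2
  push_cast
  norm_num

/-- kernel (assembled from the eight bands of 224, `WeilFormatCData.A1.wvBands_range_of_bands4`): odd reciprocal column weights against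
the arctan far diagonal, all 1792 columns, square-root minorants `O103MCBOdd.rsW / 1099512676352`, weights unpacked once (`vw_eq_vwL`). -/
theorem tWvO : checkWeightsOddV (2 ^ 320) 190 O103M.C O103M.FA O103M.ctab 256 1792 64 O103MCBOdd.vw O103MCBOdd.rsW 1099512676352 185365 1048576 = true := by
  rw [show checkWeightsOddV (2 ^ 320) 190 O103M.C O103M.FA O103M.ctab 256 1792 64 O103MCBOdd.vw O103MCBOdd.rsW 1099512676352 185365 1048576
      = (List.range 1792).all (fun t ↦ decide (0 < O103MCBOdd.vw.getD t 0) && checkSqrtLower 256 (256 + t + 1) (O103MCBOdd.rsW.getD t 0) 1099512676352 && match devOddABox (2 ^ 320) 190 O103M.C O103M.FA (tget O103M.ctab (256 + t + 1)) (256 + t) 256 (O103MCBOdd.rsW.getD t 0) 1099512676352 185365 1048576 with | some Y => decide ((2 ^ 64 : ℤ) * ((2 ^ 320 : ℕ) : ℤ) ≤ (O103MCBOdd.vw.getD t 0 : ℤ) * Y.lo) | none => false) from rfl, vw_eq_vwL]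
  exact WeilFormatCData.A1.wvBands_range_of_bands4 (a := 448) (b := 448) (c := 448) (d := 448)
    (S2FormatC.E0.band_append (n₀ := 0) (k := 224) (k' := 224) tWvOb0 tWvOb224)
    (S2FormatC.E0.band_append (n₀ := 448) (k := 224) (k' := 224) tWvOb448 tWvOb672)
    (S2FormatC.E0.band_append (n₀ := 896) (k := 224) (k' := 224) tWvOb896 tWvOb1120)
    (S2FormatC.E0.band_append (n₀ := 1344) (k := 224) (k' := 224) tWvOb1344 tWvOb1568)

/-- the mean-square tail's sine hypotheses for `s = sFun sd1 csd`, `sFun2 sdm csd`, `sFun2 sdp csd` (window written out once). -/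
theorem sines :
    (∀ k ∈ weilPrimeIndex O103M.a, IsPrimePow k → 0 ≤ sFun O103M.sd1 O103M.csd k ∧ sFun O103M.sd1 O103M.csd k ≤ |Real.sin (Real.pi * Real.log k / (((103 : ℤ) : ℝ) / (100 : ℕ)) / 2)|) ∧
    (∀ k ∈ weilPrimeIndex O103M.a, ∀ k' ∈ weilPrimeIndex O103M.a, IsPrimePow k → IsPrimePow k' → k ≠ k' →
      0 ≤ sFun2 O103M.sdm O103M.csd k k' ∧ sFun2 O103M.sdm O103M.csd k k' ≤ |Real.sin ((Real.pi * Real.log k / O103M.a - Real.pi * Real.log k' / O103M.a) / 2)|) ∧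
    (∀ k ∈ weilPrimeIndex O103M.a, ∀ k' ∈ weilPrimeIndex O103M.a, IsPrimePow k → IsPrimePow k' →
      0 ≤ sFun2 O103M.sdp O103M.csd k k' ∧ sFun2 O103M.sdp O103M.csd k k' ≤ |Real.sin ((Real.pi * Real.log k / O103M.a + Real.pi * Real.log k' / O103M.a) / 2)|) :=
  sines_of_check (prm := prm) (by norm_num [prm]) primeData consts_valid tSines

end Summit.RiemannHypothesis.RiemannHypothesis.Theorems.WeilFormatCData.O103M

-- ===== from WeilFormatCDataO103MMid =====
namespace Summit.RiemannHypothesis.RiemannHypothesis.Theorems.WeilFormatCData.O103M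
open Literature.NumberTheory.LFunctions Literature.NumberTheory.LFunctions.Yoshida1992 Encl Literature.Analysis.ValidatedNumerics.NumericsMP

/-- the odd middle moment record is valid (light table on the middle range; `B₄` as a literal). -/
theorem momO_valid : MidMomValidO (2 ^ 320) O103M.a (wvF (O103MCBOdd.vw.drop 256) 64 512) 512 2048 4 O103M.momO := by
  have h : MidMomValidO (2 ^ 320) a (wvF (O103MCBOdd.vw.drop 256) 64 512) 512 (512 + 1536) 4 (midMomO (2 ^ 320) C ctab 64 (O103MCBOdd.vw.drop 256) 512 1536 4) :=
    midMomO_valid (S := 2 ^ 320) (by norm_num) primeData consts_valid (fun m hm hmk ↦ ctab_valid m (by omega) (by omega)) 4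
  rw [show (512 + 1536 : ℕ) = 2048 from rfl] at h
  -- B g21: blocks AA/AB/BA entrywise (per-entry kernel facts `tMomO_<blk>_j_k`; one whole block exceeds the kernel memory ceiling at 1536 middle columns)
  refine ⟨fun j hj j' hj' ↦ ?_, fun j hj r hr ↦ ?_, fun r hr j hj ↦ ?_, fun r hr r' hr' ↦ by rw [tMomO_BB]; exact h.BB r hr r' hr', by rw [tMomO_sm]; exact h.sm⟩
  · interval_cases j <;> interval_cases j' <;> simp only [tMomO_AA_0_0, tMomO_AA_0_1, tMomO_AA_0_2, tMomO_AA_0_3, tMomO_AA_1_0, tMomO_AA_1_1, tMomO_AA_1_2, tMomO_AA_1_3, tMomO_AA_2_0, tMomO_AA_2_1, tMomO_AA_2_2, tMomO_AA_2_3, tMomO_AA_3_0, tMomO_AA_3_1, tMomO_AA_3_2, tMomO_AA_3_3] <;> exact h.AA _ (by norm_num) _ (by norm_num)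
  · interval_cases j <;> interval_cases r <;> simp only [tMomO_AB_0_0, tMomO_AB_0_1, tMomO_AB_0_2, tMomO_AB_0_3, tMomO_AB_1_0, tMomO_AB_1_1, tMomO_AB_1_2, tMomO_AB_1_3, tMomO_AB_2_0, tMomO_AB_2_1, tMomO_AB_2_2, tMomO_AB_2_3, tMomO_AB_3_0, tMomO_AB_3_1, tMomO_AB_3_2, tMomO_AB_3_3] <;> exact h.AB _ (by norm_num) _ (by norm_num)
  · interval_cases r <;> interval_cases j <;> simp only [tMomO_BA_0_0, tMomO_BA_0_1, tMomO_BA_0_2, tMomO_BA_0_3, tMomO_BA_1_0, tMomO_BA_1_1, tMomO_BA_1_2, tMomO_BA_1_3, tMomO_BA_2_0, tMomO_BA_2_1, tMomO_BA_2_2, tMomO_BA_2_3, tMomO_BA_3_0, tMomO_BA_3_1, tMomO_BA_3_2, tMomO_BA_3_3] <;> exact h.BA _ (by norm_num) _ (by norm_num)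

end Summit.RiemannHypothesis.RiemannHypothesis.Theorems.WeilFormatCData.O103M

-- ===== from WeilFormatCDataO103MCBOddCols0 =====
namespace Summit.RiemannHypothesis.RiemannHypothesis.Theorems.WeilFormatCData.O103MCBOdd
open Literature.NumberTheory.LFunctions Literature.NumberTheory.LFunctions.Yoshida1992 Encl Literature.Analysis.ValidatedNumerics.NumericsMP
open Summit.RiemannHypothesis.RiemannHypothesis.Theorems.WeilFormatCData.O103M

/-- column data certified below row `15`. -/
theorem colData15 : DataNear (fun i t ↦ sectorKernel true (gramCoeff O103M.a) i (256 + t)) 15 256 157 (2 ^ (157 - 1)) 154 O103MCBOdd.ρc O103MCBOdd.XP := by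
  have hT := tab_valid_odd
  have hCT := ctab_valid_oddK
  have h0 : DataNear (fun i t ↦ sectorKernel true (gramCoeff a) i (256 + t)) 0 256 157 (2 ^ (157 - 1)) 154 ρc XP := DataNear.zeroRows
  have h3 : DataNear (fun i t ↦ sectorKernel true (gramCoeff a) i (256 + t)) (0 + 3) 256 157 (2 ^ (157 - 1)) 154 ρc XP :=
    colDataNear_extendRows (S := 2 ^ 320) (by norm_num) a_pos primeData consts_valid (by norm_num : 1 ≤ 256) hT hCT true (by norm_num) rfl h0 tCol0
  have h6 : DataNear (fun i t ↦ sectorKernel true (gramCoeff a) i (256 + t)) (3 + 3) 256 157 (2 ^ (157 - 1)) 154 ρc XP :=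
    colDataNear_extendRows (S := 2 ^ 320) (by norm_num) a_pos primeData consts_valid (by norm_num : 1 ≤ 256) hT hCT true (by norm_num) rfl h3 tCol3
  have h9 : DataNear (fun i t ↦ sectorKernel true (gramCoeff a) i (256 + t)) (6 + 3) 256 157 (2 ^ (157 - 1)) 154 ρc XP :=
    colDataNear_extendRows (S := 2 ^ 320) (by norm_num) a_pos primeData consts_valid (by norm_num : 1 ≤ 256) hT hCT true (by norm_num) rfl h6 tCol6
  have h12 : DataNear (fun i t ↦ sectorKernel true (gramCoeff a) i (256 + t)) (9 + 3) 256 157 (2 ^ (157 - 1)) 154 ρc XP :=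
    colDataNear_extendRows (S := 2 ^ 320) (by norm_num) a_pos primeData consts_valid (by norm_num : 1 ≤ 256) hT hCT true (by norm_num) rfl h9 tCol9
  have h15 : DataNear (fun i t ↦ sectorKernel true (gramCoeff a) i (256 + t)) (12 + 3) 256 157 (2 ^ (157 - 1)) 154 ρc XP :=
    colDataNear_extendRows (S := 2 ^ 320) (by norm_num) a_pos primeData consts_valid (by norm_num : 1 ≤ 256) hT hCT true (by norm_num) rfl h12 tCol12
  exact h15

end Summit.RiemannHypothesis.RiemannHypothesis.Theorems.WeilFormatCData.O103MCBOdd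

-- ===== from WeilFormatCDataO103MCBOddCols1 =====
namespace Summit.RiemannHypothesis.RiemannHypothesis.Theorems.WeilFormatCData.O103MCBOdd
open Literature.NumberTheory.LFunctions Literature.NumberTheory.LFunctions.Yoshida1992 Encl Literature.Analysis.ValidatedNumerics.NumericsMP
open Summit.RiemannHypothesis.RiemannHypothesis.Theorems.WeilFormatCData.O103M

/-- column data certified below row `30`. -/
theorem colData30 : DataNear (fun i t ↦ sectorKernel true (gramCoeff O103M.a) i (256 + t)) 30 256 157 (2 ^ (157 - 1)) 154 O103MCBOdd.ρc O103MCBOdd.XP := by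
  have hT := tab_valid_odd
  have hCT := ctab_valid_oddK
  have h15 := colData15
  have h18 : DataNear (fun i t ↦ sectorKernel true (gramCoeff a) i (256 + t)) (15 + 3) 256 157 (2 ^ (157 - 1)) 154 ρc XP :=
    colDataNear_extendRows (S := 2 ^ 320) (by norm_num) a_pos primeData consts_valid (by norm_num : 1 ≤ 256) hT hCT true (by norm_num) rfl h15 tCol15
  have h21 : DataNear (fun i t ↦ sectorKernel true (gramCoeff a) i (256 + t)) (18 + 3) 256 157 (2 ^ (157 - 1)) 154 ρc XP :=
    colDataNear_extendRows (S := 2 ^ 320) (by norm_num) a_pos primeData consts_valid (by norm_num : 1 ≤ 256) hT hCT true (by norm_num) rfl h18 tCol18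
  have h24 : DataNear (fun i t ↦ sectorKernel true (gramCoeff a) i (256 + t)) (21 + 3) 256 157 (2 ^ (157 - 1)) 154 ρc XP :=
    colDataNear_extendRows (S := 2 ^ 320) (by norm_num) a_pos primeData consts_valid (by norm_num : 1 ≤ 256) hT hCT true (by norm_num) rfl h21 tCol21
  have h27 : DataNear (fun i t ↦ sectorKernel true (gramCoeff a) i (256 + t)) (24 + 3) 256 157 (2 ^ (157 - 1)) 154 ρc XP :=
    colDataNear_extendRows (S := 2 ^ 320) (by norm_num) a_pos primeData consts_valid (by norm_num : 1 ≤ 256) hT hCT true (by norm_num) rfl h24 tCol24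
  have h30 : DataNear (fun i t ↦ sectorKernel true (gramCoeff a) i (256 + t)) (27 + 3) 256 157 (2 ^ (157 - 1)) 154 ρc XP :=
    colDataNear_extendRows (S := 2 ^ 320) (by norm_num) a_pos primeData consts_valid (by norm_num : 1 ≤ 256) hT hCT true (by norm_num) rfl h27 tCol27
  exact h30

end Summit.RiemannHypothesis.RiemannHypothesis.Theorems.WeilFormatCData.O103MCBOdd

-- ===== from WeilFormatCDataO103MCBOddCols2 =====
namespace Summit.RiemannHypothesis.RiemannHypothesis.Theorems.WeilFormatCData.O103MCBOdd
open Literature.NumberTheory.LFunctions Literature.NumberTheory.LFunctions.Yoshida1992 Encl Literature.Analysis.ValidatedNumerics.NumericsMP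
open Summit.RiemannHypothesis.RiemannHypothesis.Theorems.WeilFormatCData.O103M

/-- column data certified below row `45`. -/
theorem colData45 : DataNear (fun i t ↦ sectorKernel true (gramCoeff O103M.a) i (256 + t)) 45 256 157 (2 ^ (157 - 1)) 154 O103MCBOdd.ρc O103MCBOdd.XP := by
  have hT := tab_valid_odd
  have hCT := ctab_valid_oddK
  have h30 := colData30
  have h33 : DataNear (fun i t ↦ sectorKernel true (gramCoeff a) i (256 + t)) (30 + 3) 256 157 (2 ^ (157 - 1)) 154 ρc XP :=
    colDataNear_extendRows (S := 2 ^ 320) (by norm_num) a_pos primeData consts_valid (by norm_num : 1 ≤ 256) hT hCT true (by norm_num) rfl h30 tCol30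
  have h36 : DataNear (fun i t ↦ sectorKernel true (gramCoeff a) i (256 + t)) (33 + 3) 256 157 (2 ^ (157 - 1)) 154 ρc XP :=
    colDataNear_extendRows (S := 2 ^ 320) (by norm_num) a_pos primeData consts_valid (by norm_num : 1 ≤ 256) hT hCT true (by norm_num) rfl h33 tCol33
  have h39 : DataNear (fun i t ↦ sectorKernel true (gramCoeff a) i (256 + t)) (36 + 3) 256 157 (2 ^ (157 - 1)) 154 ρc XP :=
    colDataNear_extendRows (S := 2 ^ 320) (by norm_num) a_pos primeData consts_valid (by norm_num : 1 ≤ 256) hT hCT true (by norm_num) rfl h36 tCol36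
  have h42 : DataNear (fun i t ↦ sectorKernel true (gramCoeff a) i (256 + t)) (39 + 3) 256 157 (2 ^ (157 - 1)) 154 ρc XP :=
    colDataNear_extendRows (S := 2 ^ 320) (by norm_num) a_pos primeData consts_valid (by norm_num : 1 ≤ 256) hT hCT true (by norm_num) rfl h39 tCol39
  have h45 : DataNear (fun i t ↦ sectorKernel true (gramCoeff a) i (256 + t)) (42 + 3) 256 157 (2 ^ (157 - 1)) 154 ρc XP :=
    colDataNear_extendRows (S := 2 ^ 320) (by norm_num) a_pos primeData consts_valid (by norm_num : 1 ≤ 256) hT hCT true (by norm_num) rfl h42 tCol42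
  exact h45

end Summit.RiemannHypothesis.RiemannHypothesis.Theorems.WeilFormatCData.O103MCBOdd

-- ===== from WeilFormatCDataO103MCBOddCols3 =====
namespace Summit.RiemannHypothesis.RiemannHypothesis.Theorems.WeilFormatCData.O103MCBOdd
open Literature.NumberTheory.LFunctions Literature.NumberTheory.LFunctions.Yoshida1992 Encl Literature.Analysis.ValidatedNumerics.NumericsMP
open Summit.RiemannHypothesis.RiemannHypothesis.Theorems.WeilFormatCData.O103M

/-- column data certified below row `60`. -/
theorem colData60 : DataNear (fun i t ↦ sectorKernel true (gramCoeff O103M.a) i (256 + t)) 60 256 157 (2 ^ (157 - 1)) 154 O103MCBOdd.ρc O103MCBOdd.XP := by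
  have hT := tab_valid_odd
  have hCT := ctab_valid_oddK
  have h45 := colData45
  have h48 : DataNear (fun i t ↦ sectorKernel true (gramCoeff a) i (256 + t)) (45 + 3) 256 157 (2 ^ (157 - 1)) 154 ρc XP :=
    colDataNear_extendRows (S := 2 ^ 320) (by norm_num) a_pos primeData consts_valid (by norm_num : 1 ≤ 256) hT hCT true (by norm_num) rfl h45 tCol45
  have h51 : DataNear (fun i t ↦ sectorKernel true (gramCoeff a) i (256 + t)) (48 + 3) 256 157 (2 ^ (157 - 1)) 154 ρc XP :=
    colDataNear_extendRows (S := 2 ^ 320) (by norm_num) a_pos primeData consts_valid (by norm_num : 1 ≤ 256) hT hCT true (by norm_num) rfl h48 tCol48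
  have h54 : DataNear (fun i t ↦ sectorKernel true (gramCoeff a) i (256 + t)) (51 + 3) 256 157 (2 ^ (157 - 1)) 154 ρc XP :=
    colDataNear_extendRows (S := 2 ^ 320) (by norm_num) a_pos primeData consts_valid (by norm_num : 1 ≤ 256) hT hCT true (by norm_num) rfl h51 tCol51
  have h57 : DataNear (fun i t ↦ sectorKernel true (gramCoeff a) i (256 + t)) (54 + 3) 256 157 (2 ^ (157 - 1)) 154 ρc XP :=
    colDataNear_extendRows (S := 2 ^ 320) (by norm_num) a_pos primeData consts_valid (by norm_num : 1 ≤ 256) hT hCT true (by norm_num) rfl h54 tCol54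
  have h60 : DataNear (fun i t ↦ sectorKernel true (gramCoeff a) i (256 + t)) (57 + 3) 256 157 (2 ^ (157 - 1)) 154 ρc XP :=
    colDataNear_extendRows (S := 2 ^ 320) (by norm_num) a_pos primeData consts_valid (by norm_num : 1 ≤ 256) hT hCT true (by norm_num) rfl h57 tCol57
  exact h60

end Summit.RiemannHypothesis.RiemannHypothesis.Theorems.WeilFormatCData.O103MCBOdd
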